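import Summits.KontsevichZagierPeriods.KontsevichZagierPeriods.Theorems.FermatIsogenyBetaLinearSectorSixthsIsogeny
import HarnessLib

/-!
# `BetaLinearSector` (stmt-KontsevichZagierPeriods-3897), line `fermat-sector-transport` —
# stub `stub_link43_tail_of_iso` (link L1 of the level-6 rung: `B(2/3,1/2) = 2√3·∫₁^∞ dX/(X²√(X³−1))`)

The level-`6` rung of the crux `BetaLinearSector` (route FermatIsogeny) chains the Beta cell
`β(2/3,1/2) = [(0,1), t^{-1/3}(1-t)^{-1/2}]` to the tail `[(1,∞), 2√3/(X²√(X³−1))]` of the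
second-kind differential `dX/(X²Y)` on `E₋ : Y² = X³ − 1`, GIVEN the second-kind `3`-isogeny
pull-back on the arc `(−1,0)` of `E₊ : y² = x³ + 1` (the hypothesis, a neighbouring stub:
`[(−1,0), 9√3x⁴/((x³+4)²√(x³+1))] ∼ [(1,∞), 1/(X²√(X³−1))]`).  The chain, all inside the
Kontsevich–Zagier calculus of moves (`KZCalculus.lean`):

1. ONE change of variables `t = −x³` from the arc `x ∈ (−1,0)` onto `t ∈ (0,1)` (rule (2);
   `t^{-1/3} = 1/(−x)`, `(1−t)^{-1/2} = 1/√(1+x³)`, `|dt/dx| = 3x²`):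
   `[β(2/3,1/2)] ∼ P := [(−1,0), −3x/√(x³+1)]` (`link43_cubicArc_pullback`);
2. the EXACT CORRECTION `F(x) = 6x²√(x³+1)/(x³+4)`, continuous on `[−1,0]`, `F(−1) = F(0) = 0`,
   `F′(x) = 54x⁴/((x³+4)²√(x³+1)) + 3x/√(x³+1)` on `(−1,0)` (`link43_hasDerivAt_primitive`), so
   `[(−1,0), F′] ∈ relations` (ONE Newton–Leibniz move from the point over the band `[−1,0]`
   plus the null boundary, `of_mem_relations_of_hasDerivAt`) and ONE integrand-additivity move
   gives `P ∼ Q := [(−1,0), 54x⁴/((x³+4)²√(x³+1))]`;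
3. `Q = (2√3)·(√3·[(−1,0), 9x⁴/((x³+4)²√(x³+1))])` literally (`54 = 2√3·9√3`), the hypothesis
   and the scaling endomorphism (`KZ.Equivalent.constMul`) give `Q ∼ (2√3)·[(1,∞), 1/(X²√(X³−1))]`,
   which has the integrand of the target on the common domain (`KZ.of_sub_of_mem_relations_of_eqOn`).

The three auxiliary representations (on the arc: `−3x/√(x³+1)`, `9x⁴/((x³+4)²√(x³+1))`; on the
tail: `1/(X²√(X³−1))`) are dominated by the landed sector representations `a/√(x³±1)`
(`exists_cubicPlusRep`, `exists_cubicMinusRep`), whence their absolute integrability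
(`link43_exists_rep_of_abs_le`).  Value check: `B(2/3,1/2) = 2.58711 = 2√3 × 0.746834`.

References: M. Kontsevich, D. Zagier, *Periods* (2001), §1.2 rules (1)–(3); G. E. Andrews,
R. Askey, R. Roy, *Special Functions* (1999), §1.1.
-/

noncomputable section

namespace Summit.KontsevichZagierPeriods.FermatIsogeny.BetaLinearSector.Sixths

open Set MeasureTheory
open MvPolynomial (aeval X C)
open Literature.NumberTheory.Transcendental Literature.NumberTheory.Transcendental.KZ
open Literature.ModelTheory.ExponentialFields (IsSemialgebraic)
open Summit.KontsevichZagierPeriods.HermiteRigidity.CMTwistQuasiPeriodTransfer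
  (of_sub_of_mem_changeOfVariablesRel_dimOne of_mem_relations_of_hasDerivAt)
open Summit.KontsevichZagierPeriods.KontsevichZagierPeriods.Theorems.GKZLevelThree
  (isSemialgebraicFunOn_ratFun₁)
open Summit.KontsevichZagierPeriods.TorsionLogs.CertificateDlogUnfolds (cube_add_one_pos)

/-! ## Real analysis of the two integrands -/

/-- The pull-back identity along `u = -x³` for the exponent pair `(-1/3, -1/2)`: for `-1 < x < 0`,
`u^{-1/3} (1-u)^{-1/2} · |-(3x²)| = -3x/√(x³+1)` (`(-x³)^{-1/3} = (-x)^{-1}`). [folklore] -/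
theorem link43_cubicArc_pullback {x : ℝ} (h0 : -1 < x) (h1 : x < 0) :
    (-x ^ 3) ^ (-(1:ℝ) / 3) * (1 - -x ^ 3) ^ (-(1:ℝ) / 2) * |-(3 * x ^ 2)| =
      -(3 * x) / Real.sqrt (x ^ 3 + 1) := by
  have hnx : 0 < -x := by linarith
  have hP : 0 < x ^ 3 + 1 := cube_add_one_pos h0
  have hs : 0 < Real.sqrt (x ^ 3 + 1) := Real.sqrt_pos.2 hP
  -- `(-x³)^{-1/3} = ((-x)³)^{-1/3} = (-x)^{-1}`
  have hA : (-x ^ 3) ^ (-(1:ℝ) / 3) = (-x)⁻¹ := by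
    rw [show (-x ^ 3 : ℝ) = (-x) ^ 3 by ring, show ((-x) ^ 3 : ℝ) = (-x) ^ (3:ℝ) by norm_cast,
      ← Real.rpow_mul hnx.le, show ((3:ℝ) * (-(1:ℝ) / 3) : ℝ) = -1 by norm_num, Real.rpow_neg_one]
  -- `(1 - (-x³))^{-1/2} = (√(x³+1))⁻¹`
  have hB : (1 - -x ^ 3) ^ (-(1:ℝ) / 2) = (Real.sqrt (x ^ 3 + 1))⁻¹ := by
    rw [show (1 - -x ^ 3 : ℝ) = x ^ 3 + 1 by ring, Real.sqrt_eq_rpow, ← Real.rpow_neg hP.le,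
      neg_div]
  have habs : |-(3 * x ^ 2)| = 3 * x ^ 2 := by
    rw [abs_neg]
    exact abs_of_nonneg (by positivity)
  rw [hA, hB, habs]
  field_simp

/-- The exact correction: `F(x) = 6x²√(x³+1)/(x³+4)` has derivative
`54x⁴/((x³+4)²√(x³+1)) + 3x/√(x³+1)` at every `x > -1` (quotient rule and `(√g)' = g'/(2√g)`,
then `y² = x³ + 1`: the numerator is `3x⁷ + 78x⁴ + 48x = 54x⁴ + 3x(x³+4)²`). [folklore] -/
theorem link43_hasDerivAt_primitive {x : ℝ} (hx : -1 < x) :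
    HasDerivAt (fun s : ℝ => 6 * s ^ 2 * Real.sqrt (s ^ 3 + 1) / (s ^ 3 + 4))
      (54 * x ^ 4 / ((x ^ 3 + 4) ^ 2 * Real.sqrt (x ^ 3 + 1)) + 3 * x / Real.sqrt (x ^ 3 + 1)) x := by
  have hP : 0 < x ^ 3 + 1 := cube_add_one_pos hx
  have hy : 0 < Real.sqrt (x ^ 3 + 1) := Real.sqrt_pos.2 hP
  have hD : x ^ 3 + 4 ≠ 0 := (by linarith : (0:ℝ) < x ^ 3 + 4).ne'
  have h1 : HasDerivAt (fun s : ℝ => s ^ 3 + 1) (3 * x ^ 2) x := by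
    simpa using (hasDerivAt_pow 3 x).add_const 1
  have h2 : HasDerivAt (fun s : ℝ => Real.sqrt (s ^ 3 + 1))
      (3 * x ^ 2 / (2 * Real.sqrt (x ^ 3 + 1))) x := h1.sqrt hP.ne'
  have h3 : HasDerivAt (fun s : ℝ => 6 * s ^ 2) (6 * (2 * x)) x := by
    simpa using (hasDerivAt_pow 2 x).const_mul (6:ℝ)
  have h4 : HasDerivAt (fun s : ℝ => s ^ 3 + 4) (3 * x ^ 2) x := by
    simpa using (hasDerivAt_pow 3 x).add_const 4
  refine ((h3.fun_mul h2).fun_div h4 hD).congr_deriv ?_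
  set y := Real.sqrt (x ^ 3 + 1) with hy_def
  have hy2 : y ^ 2 = x ^ 3 + 1 := Real.sq_sqrt hP.le
  field_simp
  linear_combination (96 * x - 12 * x ^ 4) * hy2

/-! ## Dominated integrands give representations -/

/-- A `ℚ`-semialgebraic function on a `ℚ`-semialgebraic subset `E` of the domain of a representation
`r`, dominated there by the integrand of `r`, is the integrand of a representation on `E`
(semialgebraic functions are measurable; dominated measurable functions are integrable). [folklore] -/
theorem link43_exists_rep_of_abs_le (r : IntegralRep 1) {E : Set (Fin 1 → ℝ)}
    (hE : IsSemialgebraic ℚ E) (hEr : E ⊆ r.domain) {g : (Fin 1 → ℝ) → ℝ}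
    (hg : IsSemialgebraicFunOn ℚ E g) (hle : ∀ x ∈ E, |g x| ≤ r.integrand x) :
    ∃ ρ : IntegralRep 1, ρ.domain = E ∧ ρ.integrand = g := by
  have hEm : MeasurableSet E := Literature.ModelTheory.ExponentialFields.IsSemialgebraic.measurableSet_holds hE
  refine ⟨⟨E, g, hE, hg, ?_⟩, rfl, rfl⟩
  exact Integrable.mono' (r.integrableOn.mono_set hEr) (KZ.aestronglyMeasurable_of_isSemialgebraicFunOn hg hEm)
    ((ae_restrict_iff' hEm).2 (Filter.Eventually.of_forall fun x hx => by
      rw [Real.norm_eq_abs]; exact hle x hx))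

/-! ## The link -/

/-- **Stub `stub_link43_tail_of_iso`** (line `fermat-sector-transport` of `BetaLinearSector`, level `6`,
link L1): GIVEN the second-kind `3`-isogeny pull-back on the arc `(−1,0)`
(`[(−1,0), 9√3x⁴/((x³+4)²√(x³+1))] ∼ [(1,∞), 1/(X²√(X³−1))]` for all so-pinned representations),
every Beta cell `[(0,1), t^{-1/3}(1-t)^{-1/2}]` (value `B(2/3,1/2)`) is KZ-equivalent to every
representation `[(1,∞), 2√3/(X²√(X³−1))]`: ONE change of variables `t = −x³` onto the arc, ONE
Newton–Leibniz move with the primitive `6x²√(x³+1)/(x³+4)` (vanishing at `−1` and `0`) plus the null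
boundary and ONE integrand-additivity move, then the hypothesis scaled by the algebraic constant `2√3`.
[cite: KontsevichZagier2001, §1.2 rules (1)–(3)] -/
theorem stub_link43_tail_of_iso :
    (∀ (S T : KZ.IntegralRep 1), S.domain = {x | -1 < x 0 ∧ x 0 < 0} →
      Set.EqOn S.integrand (fun x => 9 * Real.sqrt 3 * x 0 ^ 4 / ((x 0 ^ 3 + 4) ^ 2 * Real.sqrt (x 0 ^ 3 + 1))) S.domain →
      T.domain = {x | 1 < x 0} →
      Set.EqOn T.integrand (fun x => 1 / (x 0 ^ 2 * Real.sqrt (x 0 ^ 3 - 1))) T.domain → KZ.Equivalent S T) →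
    ∀ (U A : KZ.IntegralRep 1), U.domain = {x | x 0 ∈ Set.Ioo (0:ℝ) 1} →
      Set.EqOn U.integrand (fun x => (x 0) ^ (-(1:ℝ) / 3) * (1 - x 0) ^ (-(1:ℝ) / 2)) U.domain →
      A.domain = {x | 1 < x 0} →
      Set.EqOn A.integrand (fun x => 2 * Real.sqrt 3 / (x 0 ^ 2 * Real.sqrt (x 0 ^ 3 - 1))) A.domain → KZ.Equivalent U A := by
  intro hiso U A hUd hUi hAd hAi
  -- algebraic constants
  have hs3 : Real.sqrt 3 ^ 2 = 3 := Real.sq_sqrt (by norm_num)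
  have hs3' : Real.sqrt 3 * Real.sqrt 3 = 3 := Real.mul_self_sqrt (by norm_num)
  have h3 : IsAlgebraic ℚ (Real.sqrt 3) := by
    refine ⟨Polynomial.X ^ 2 - Polynomial.C 3, Polynomial.X_pow_sub_C_ne_zero (by norm_num) 3, ?_⟩
    simp [hs3]
  have h2 : IsAlgebraic ℚ (2:ℝ) := by simpa using isAlgebraic_nat (R := ℚ) (A := ℝ) 2
  have h23 : IsAlgebraic ℚ (2 * Real.sqrt 3) := h2.mul h3
  have hm1 : IsAlgebraic ℚ (-1:ℝ) := by simpa using isAlgebraic_int (R := ℚ) (A := ℝ) (-1)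
  -- the arc `(−1,0)` and the tail `(1,∞)` in `ℝ¹`
  set arc : Set (Fin 1 → ℝ) := {x | -1 < x 0 ∧ x 0 < 0} with harc
  set tail : Set (Fin 1 → ℝ) := {x | 1 < x 0} with htail
  have hArc : IsSemialgebraic ℚ arc :=
    (KZ.isSemialgebraic_setOf_const_lt_apply hm1 0).inter
      (KZ.isSemialgebraic_setOf_apply_lt_const isAlgebraic_zero 0)
  have hTail : IsSemialgebraic ℚ tail := KZ.isSemialgebraic_setOf_const_lt_apply isAlgebraic_one 0
  -- semialgebraic atoms (polynomials, `√(x³ ± 1)`) and the four algebraic integrands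
  have hpol : ∀ (q : MvPolynomial (Fin 1) ℚ) (f : (Fin 1 → ℝ) → ℝ), (∀ p, aeval p q = f p) →
      IsSemialgebraicFunOn ℚ arc f := fun q f hf =>
    (isSemialgebraicFunOn_aeval hArc q).congr fun p _ => hf p
  have hpol' : ∀ (q : MvPolynomial (Fin 1) ℚ) (f : (Fin 1 → ℝ) → ℝ), (∀ p, aeval p q = f p) →
      IsSemialgebraicFunOn ℚ tail f := fun q f hf =>
    (isSemialgebraicFunOn_aeval hTail q).congr fun p _ => hf p
  have hcub : IsSemialgebraicFunOn ℚ arc (fun p => p 0 ^ 3 + 1) := hpol (X 0 ^ 3 + 1) _ fun p => by simp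
  have hsq : IsSemialgebraicFunOn ℚ arc (fun p => Real.sqrt (p 0 ^ 3 + 1)) := hcub.fun_sqrt
  have hden4 : IsSemialgebraicFunOn ℚ arc (fun p => p 0 ^ 3 + 4) := hpol (X 0 ^ 3 + 4) _ fun p => by simp
  have hlin3 : IsSemialgebraicFunOn ℚ arc (fun p => -(3 * p 0)) := hpol (-(3 * X 0)) _ fun p => by simp
  have h9x4 : IsSemialgebraicFunOn ℚ arc (fun p => 9 * p 0 ^ 4) := hpol (9 * X 0 ^ 4) _ fun p => by simp
  have h6x2 : IsSemialgebraicFunOn ℚ arc (fun p => 6 * p 0 ^ 2) := hpol (6 * X 0 ^ 2) _ fun p => by simp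
  have hX2 : IsSemialgebraicFunOn ℚ tail (fun p => p 0 ^ 2) := hpol' (X 0 ^ 2) _ fun p => by simp
  have hsqm : IsSemialgebraicFunOn ℚ tail (fun p => Real.sqrt (p 0 ^ 3 - 1)) :=
    (hpol' (X 0 ^ 3 - 1) (fun p => p 0 ^ 3 - 1) fun p => by simp).fun_sqrt
  have hPsa : IsSemialgebraicFunOn ℚ arc (fun p => -(3 * p 0) / Real.sqrt (p 0 ^ 3 + 1)) :=
    (hlin3.fun_mul hsq.fun_inv).congr fun p _ => by rw [div_eq_mul_inv]
  have hS₀sa : IsSemialgebraicFunOn ℚ arc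
      (fun p => 9 * p 0 ^ 4 / ((p 0 ^ 3 + 4) ^ 2 * Real.sqrt (p 0 ^ 3 + 1))) :=
    (h9x4.fun_mul ((hden4.fun_pow 2).fun_mul hsq).fun_inv).congr fun p _ => by rw [div_eq_mul_inv]
  have hTsa : IsSemialgebraicFunOn ℚ tail (fun p => 1 / (p 0 ^ 2 * Real.sqrt (p 0 ^ 3 - 1))) :=
    (hX2.fun_mul hsqm).fun_inv.congr fun p _ => by rw [one_div]
  have hFsa : IsSemialgebraicFunOn ℚ arc
      (fun p => 6 * p 0 ^ 2 * Real.sqrt (p 0 ^ 3 + 1) / (p 0 ^ 3 + 4)) :=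
    ((h6x2.fun_mul hsq).fun_mul hden4.fun_inv).congr fun p _ => by rw [div_eq_mul_inv]
  -- the dominating sector representations `a/√(x³+1)` on `(−1,∞)` and `1/√(X³−1)` on `(1,∞)`
  obtain ⟨S₃, hS₃d, hS₃i⟩ := exists_cubicPlusRep 3
  obtain ⟨S₁, hS₁d, hS₁i⟩ := exists_cubicPlusRep 1
  obtain ⟨T₁, hT₁d, hT₁i⟩ := exists_cubicMinusRep 1
  have harcS₃ : arc ⊆ S₃.domain := fun p hp => by rw [hS₃d]; exact hp.1
  have harcS₁ : arc ⊆ S₁.domain := fun p hp => by rw [hS₁d]; exact hp.1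
  -- `P = [(−1,0), −3x/√(x³+1)]`
  obtain ⟨P, hPd, hPi⟩ : ∃ P : IntegralRep 1, P.domain = arc ∧
      P.integrand = fun p => -(3 * p 0) / Real.sqrt (p 0 ^ 3 + 1) := by
    refine link43_exists_rep_of_abs_le S₃ hArc harcS₃ hPsa fun p hp => ?_
    have hs : 0 < Real.sqrt (p 0 ^ 3 + 1) := Real.sqrt_pos.2 (cube_add_one_pos hp.1)
    simp only [hS₃i]
    push_cast
    rw [abs_of_nonneg (div_nonneg (by linarith [hp.2]) hs.le)]
    exact div_le_div_of_nonneg_right (by linarith [hp.1]) hs.le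
  -- `S₀ = [(−1,0), 9x⁴/((x³+4)²√(x³+1))]`
  obtain ⟨S₀, hS₀d, hS₀i⟩ : ∃ S₀ : IntegralRep 1, S₀.domain = arc ∧
      S₀.integrand = fun p => 9 * p 0 ^ 4 / ((p 0 ^ 3 + 4) ^ 2 * Real.sqrt (p 0 ^ 3 + 1)) := by
    refine link43_exists_rep_of_abs_le S₁ hArc harcS₁ hS₀sa fun p hp => ?_
    have hP1 : 0 < p 0 ^ 3 + 1 := cube_add_one_pos hp.1
    have hs : 0 < Real.sqrt (p 0 ^ 3 + 1) := Real.sqrt_pos.2 hP1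
    have hlt : p 0 < 0 := hp.2
    have hsq1 : p 0 ^ 2 < 1 := by nlinarith [hp.1]
    have hx4 : p 0 ^ 4 ≤ 1 := by nlinarith [sq_nonneg (p 0)]
    have h9 : 9 * p 0 ^ 4 ≤ (p 0 ^ 3 + 4) ^ 2 := by nlinarith
    simp only [hS₁i, Rat.cast_one]
    rw [abs_of_nonneg (by positivity), ← div_div]
    exact div_le_div_of_nonneg_right ((div_le_one (pow_pos (by linarith) 2)).2 h9) hs.le
  -- `T = [(1,∞), 1/(X²√(X³−1))]`
  obtain ⟨T, hTd, hTi⟩ : ∃ T : IntegralRep 1, T.domain = tail ∧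
      T.integrand = fun p => 1 / (p 0 ^ 2 * Real.sqrt (p 0 ^ 3 - 1)) := by
    refine link43_exists_rep_of_abs_le T₁ hTail (fun p hp => by rw [hT₁d]; exact hp) hTsa fun p hp => ?_
    have hp1 : 1 < p 0 := hp
    have hs : 0 < Real.sqrt (p 0 ^ 3 - 1) := Real.sqrt_pos.2 ((cube_sub_one_pos_iff _).2 hp1)
    simp only [hT₁i, Rat.cast_one]
    rw [abs_of_nonneg (by positivity), ← div_div]
    exact div_le_div_of_nonneg_right (div_le_one_of_le₀ (by nlinarith) (by positivity)) hs.le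
  -- the hypothesis: `S = √3·S₀ ∼ T`, scaled by `2√3`: `Q = (2√3)·S ∼ (2√3)·T ∼ A`
  set S := S₀.constMul (Real.sqrt 3) h3 with hS
  have hST : KZ.Equivalent S T :=
    hiso S T (by rw [hS, IntegralRep.domain_constMul, hS₀d]) (fun x _ => by
      simp only [hS, IntegralRep.integrand_constMul, hS₀i]; ring) hTd (fun x _ => by rw [hTi])
  set Q := S.constMul (2 * Real.sqrt 3) h23 with hQ
  have hQT : KZ.Equivalent Q (T.constMul (2 * Real.sqrt 3) h23) := hST.constMul (2 * Real.sqrt 3) h23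
  have hTA : KZ.Equivalent (T.constMul (2 * Real.sqrt 3) h23) A := by
    refine KZ.of_sub_of_mem_relations_of_eqOn (by rw [IntegralRep.domain_constMul, hTd, hAd])
      fun x hx => ?_
    have hxA : x ∈ A.domain := by
      rw [IntegralRep.domain_constMul, hTd] at hx
      rw [hAd]
      exact hx
    rw [hAi hxA]
    simp only [IntegralRep.integrand_constMul, hTi]
    ring
  -- the exact correction `D = [(−1,0), Q.integrand − P.integrand] = [(−1,0), F′]` is a relation
  have hQd : Q.domain = arc := by
    rw [hQ, IntegralRep.domain_constMul, hS, IntegralRep.domain_constMul, hS₀d]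
  have hQi : ∀ p, Q.integrand p =
      2 * Real.sqrt 3 * (Real.sqrt 3 * (9 * p 0 ^ 4 / ((p 0 ^ 3 + 4) ^ 2 * Real.sqrt (p 0 ^ 3 + 1)))) :=
    fun p => by simp only [hQ, hS, IntegralRep.integrand_constMul, hS₀i]
  have hQsa : IsSemialgebraicFunOn ℚ arc Q.integrand := hQd ▸ Q.isSemialgebraicFunOn_integrand
  have hPsa' : IsSemialgebraicFunOn ℚ arc P.integrand := hPd ▸ P.isSemialgebraicFunOn_integrand
  have hQint : IntegrableOn Q.integrand arc := hQd ▸ Q.integrableOn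
  have hPint : IntegrableOn P.integrand arc := hPd ▸ P.integrableOn
  obtain ⟨D, hDd, hDi⟩ : ∃ D : IntegralRep 1, D.domain = arc ∧
      D.integrand = fun p => Q.integrand p - P.integrand p :=
    ⟨⟨arc, fun p => Q.integrand p - P.integrand p, hArc, hQsa.fun_sub hPsa', hQint.sub hPint⟩, rfl, rfl⟩
  have hDrel : KZ.of D ∈ KZ.relations := by
    refine of_mem_relations_of_hasDerivAt (u := -1) (v := 0) (by norm_num) hm1 isAlgebraic_zero
      (fun x => 6 * x ^ 2 * Real.sqrt (x ^ 3 + 1) / (x ^ 3 + 4)) D (by rw [hDd]) (by rw [hDd]; exact hFsa)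
      ?_ ?_ (by norm_num) (by norm_num)
    · -- continuity of the primitive on the closed band `[−1, 0]`
      refine ContinuousOn.div (by fun_prop) (by fun_prop) fun x hx h0 => ?_
      have h := mul_nonneg (show (0:ℝ) ≤ x + 1 by linarith [hx.1])
        (show (0:ℝ) ≤ x ^ 2 - x + 1 by nlinarith [sq_nonneg (x - 1 / 2)])
      nlinarith
    · -- its derivative on the open arc is the integrand of `D`
      intro p hp
      rw [hDd] at hp
      refine (link43_hasDerivAt_primitive hp.1).congr_deriv ?_
      rw [hDi]
      simp only [hQi, hPi]
      linear_combination (-(18 * p 0 ^ 4 / ((p 0 ^ 3 + 4) ^ 2 * Real.sqrt (p 0 ^ 3 + 1)))) * hs3'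
  -- ONE integrand-additivity move: `Q = P + D` on the arc
  have hadd : KZ.of Q - KZ.of P - KZ.of D ∈ KZ.integrandAddRel :=
    ⟨1, Q, P, D, by rw [hPd, hQd], by rw [hDd, hQd], fun x _ => by simp only [Pi.add_apply, hDi]; ring, rfl⟩
  have hQP : KZ.Equivalent Q P := by
    have := KZ.relations.add_mem (KZ.integrandAddRel_subset_relations hadd) hDrel
    rwa [sub_add_cancel] at this
  -- ONE change of variables `u = −x³` from the arc onto `(0,1)`: `P ∼ U`
  have hPU : KZ.Equivalent P U := by
    set φ : ℝ → ℝ := fun x => -x ^ 3 with hφ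
    set φ' : ℝ → ℝ := fun x => -(3 * x ^ 2) with hφ'
    refine changeOfVariablesRel_subset_relations
      (of_sub_of_mem_changeOfVariablesRel_dimOne P U φ φ' ?_ (fun p _ => cubicArc_hasDerivAt (p 0))
        ?_ ?_ ?_)
    · -- `Φ` is a `ℚ`-polynomial, hence `ℚ`-semialgebraic on the domain
      refine isSemialgebraicFunOn_ratFun₁ P.isSemialgebraic_domain (-(X 0 ^ 3)) 1 φ
        (fun x _ => by simp) (fun x _ => ?_)
      simp [hφ]
    · -- injectivity
      intro p _ q _ hpq
      exact cubicArc_inj hpq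
    · -- the image is `(0, 1)`
      rw [hUd, hPd, harc]
      ext y
      simp only [mem_setOf_eq, mem_image]
      constructor
      · intro hy
        have : y 0 ∈ φ '' {x : ℝ | -1 < x ∧ x < 0} := by rw [cubicArc_image]; exact hy
        obtain ⟨w, hw, hwy⟩ := this
        exact ⟨fun _ => w, hw, funext fun i => by rw [Subsingleton.elim i 0]; exact hwy⟩
      · rintro ⟨p, hp, rfl⟩
        exact cubicArc_mem_Ioo hp.1 hp.2
    · -- the pull-back identity on the domain
      intro p hp
      have hp' : -1 < p 0 ∧ p 0 < 0 := by rw [hPd] at hp; exact hp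
      have hφp : (fun _ : Fin 1 => φ (p 0)) ∈ U.domain := by
        rw [hUd]
        exact cubicArc_mem_Ioo hp'.1 hp'.2
      rw [hPi, hUi hφp]
      exact (link43_cubicArc_pullback hp'.1 hp'.2).symm
  -- compose: `U ∼ P ∼ Q ∼ (2√3)·T ∼ A`
  exact hPU.symm.trans (hQP.symm.trans (hQT.trans hTA))

end Summit.KontsevichZagierPeriods.FermatIsogeny.BetaLinearSector.Sixths

end
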